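import Mathlib.CategoryTheory.Limits.Constructions.Over.Connected
import Literature.AlgebraicGeometry.Motives.EtaleToProetDensity
import HarnessLib

/-!
# Covers of `X_proét` and of `X_proét^aff`: quasi-compactness, finite affine refinements, and the
# induced topology on pro-étale affines as finite jointly surjective families (under Lemma 4.2.4)

Infrastructure for the sheaf-theoretic steps of Bhatt–Scholze §4.2 / Lemma 5.1.1 on Mathlib's
carriers (the plan for discharging `isSheaf_lan_comp_proetAffineInclusion`, see
`EtaleToProetDensity.lean`): covers of `X_proét` are *fpqc* covers (Def. 4.1.1: "a family
`{Y_i → Y}` of maps in `X_proét` is a covering family if any open affine in `Y` is mapped onto by an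
open affine in `⊔_i Y_i`"), so over a quasi-compact object finitely many affine pieces suffice, and
on the site `X_proét^aff` of pro-étale affines every cover is refined by a finite family of
pro-étale affines once pro-étale affines generate `X_proét` (Lemma 4.2.4) — the reduction behind
Lemma 4.2.6 ("A presheaf `F` on `X_proét` is a sheaf if and only if: for any surjection `V → U` in
`X_proét^aff` the sequence `F(U) → F(V) ⇉ F(V ×_U V)` is exact; `F` is a Zariski sheaf"). Proved:

* `isAffine_left_of_presentation` — **a pro-étale affine is an affine scheme** (Def. 4.2.1: "each
  `U ∈ X_proét^aff` is, in particular, an affine scheme"; a limit of affine schemes is affine,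
  Mathlib `Scheme.isAffine_of_isLimit`);
* `weaklyEtale_left` — **any map in `X_proét` is weakly étale** (Lemma 4.1.7);
* `exists_finite_affine_of_mem_proEtTopology` — a pro-étale covering sieve of a quasi-compact
  `U ∈ X_proét` contains finitely many morphisms from objects with *affine* underlying scheme which
  are jointly surjective (Def. 4.1.1; Mathlib `QuasiCompactCover.exists_isAffineOpen_of_isCompact`);
* `ofArrows_mem_proEtTopology` — conversely, a finite jointly surjective family of morphisms of
  `X_proét` from affine objects to an affine object generates a covering sieve (it is a quasi-compact
  cover by weakly étale maps);
* `exists_finite_proetAffine_of_mem_proEtTopology` — under Lemma 4.2.4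
  (`(proetAffineInclusion X).IsCoverDense`), the affine pieces may be taken to be pro-étale affines;
* `exists_finite_of_mem_proetAffineTopology`, `mem_proetAffineTopology_of_exists` — under
  Lemma 4.2.4, **a sieve of `X_proét^aff` is covering for the induced topology iff it contains a
  finite jointly surjective family** (Remark 4.2.5: `X_proét^aff` "becomes a site with covers
  defined to be fpqc covers").

## References

* B. Bhatt, P. Scholze, *The pro-étale topology for schemes*, Astérisque 369 (2015)
  (arXiv:1309.1198, held; arXiv pages): Def. 4.1.1 and Lemma 4.1.7 (p. 23), Def. 4.2.1,
  Lemma 4.2.4, Remark 4.2.5, Lemma 4.2.6 (p. 24). [BhattScholze2015]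

## Design notes

* `proetOfOpensOver`/`proetOfOpensOverHom` package an open of a member of a pro-étale cover of `U`
  as an object of `X.ProEt` over `U` (composite `V ↪ Y → U → X` of weakly étale maps).
* Finite families are indexed by `Fin n` resp. a `Finite` type in `Type`; statements under
  Lemma 4.2.4 take `[(proetAffineInclusion X).IsCoverDense (ProEt.topology X)]` as an instance
  hypothesis (the named fact `isCoverDense_proetAffineInclusion` supplies it).
* Mathlib searches: `Precoverage.mem_toGrothendieck_iff_of_isStableUnderComposition`,
  `QuasiCompactCover.exists_isAffineOpen_of_isCompact`, `QuasiCompactCover.of_finite`,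
  `Scheme.Cover.ofQuasiCompactCover`, `Scheme.Cover.mkOfCovers`, `Scheme.isAffine_of_isLimit`,
  `Functor.mem_inducedTopology_iff_of_isCoverDense`; Mathlib has no instance making morphisms of
  `Scheme.ProEt` weakly étale (only the structure maps), and no affine sub-site of `X.ProEt`.
  Nothing restated.
-/

universe u

open CategoryTheory Limits Opposite AlgebraicGeometry

noncomputable section

namespace Literature.AlgebraicGeometry.Motives

section Affine

variable {X : Scheme.{u}} {W : X.ProEt}

/-- **A pro-étale affine is an affine scheme**: the underlying scheme of `W = lim_i U_i` is affine
(Bhatt–Scholze Def. 4.2.1: "each `U ∈ X_proét^aff` is, in particular, an affine scheme pro-étale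
over `X`"; a limit of affine schemes is affine, Mathlib `Scheme.isAffine_of_isLimit`, the forgetful
functor `Over X ⥤ Scheme` preserving the connected limit). [cite: BhattScholze2015, Def. 4.2.1] -/
theorem isAffine_left_of_presentation (𝔭 : ProetAffinePresentation X W) : IsAffine W.left := by
  haveI : ∀ i, IsAffine (((𝔭.diagram ⋙ Scheme.Etale.forget X) ⋙ Over.forget X).obj i) :=
    fun i => 𝔭.isAffine i
  exact Scheme.isAffine_of_isLimit _ (isLimitOfPreserves (Over.forget X) 𝔭.isLimitOverCone)

end Affine

section Covers

variable {X : Scheme.{u}}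

/-- **Any map in `X_proét` is weakly étale** (Bhatt–Scholze Lemma 4.1.7; two-out-of-three for
weakly étale morphisms, Mathlib `WeaklyEtale.of_comp`). [cite: BhattScholze2015, Lemma 4.1.7] -/
theorem weaklyEtale_left {U V : X.ProEt} (f : U ⟶ V) : WeaklyEtale f.left :=
  have hw : f.left ≫ V.hom = U.hom := Over.w ((Scheme.ProEt.forget X).map f)
  @WeaklyEtale.of_comp _ _ _ f.left V.hom (hw.symm ▸ (U.prop : WeaklyEtale U.hom))
    (V.prop : WeaklyEtale V.hom)

/-- An open `V ⊆ Y` of a weakly étale `U`-scheme `q : Y → U` (`U ∈ X_proét`), as an object of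
`X_proét`: the composite `V ↪ Y → U → X` is weakly étale. [folklore] -/
def proetOfOpensOver (U : X.ProEt) {Y : Scheme.{u}} (q : Y ⟶ U.left) (hq : WeaklyEtale q)
    (V : Y.Opens) : X.ProEt :=
  MorphismProperty.Over.mk ⊤ ((V.ι ≫ q) ≫ U.hom)
    (MorphismProperty.comp_mem _ _ _ (MorphismProperty.comp_mem _ _ _
      (inferInstance : WeaklyEtale V.ι) hq) U.prop)

/-- Its underlying scheme is `V` (by `rfl`). [folklore] -/
@[simp] theorem proetOfOpensOver_left (U : X.ProEt) {Y : Scheme.{u}} (q : Y ⟶ U.left)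
    (hq : WeaklyEtale q) (V : Y.Opens) : (proetOfOpensOver U q hq V).left = V := rfl

/-- Its structure map is `V ↪ Y → U → X` (by `rfl`). [folklore] -/
@[simp] theorem proetOfOpensOver_hom (U : X.ProEt) {Y : Scheme.{u}} (q : Y ⟶ U.left)
    (hq : WeaklyEtale q) (V : Y.Opens) : (proetOfOpensOver U q hq V).hom = (V.ι ≫ q) ≫ U.hom := rfl

/-- The morphism `V ↪ Y → Z` of `X_proét`, for `Z ∈ X_proét` and `l : Y → Z` over `U`. [folklore] -/
def proetOfOpensOverHom (U : X.ProEt) {Y : Scheme.{u}} (q : Y ⟶ U.left) (hq : WeaklyEtale q)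
    (V : Y.Opens) (Z : X.ProEt) (l : Y ⟶ Z.left) (hl : l ≫ Z.hom = q ≫ U.hom) :
    proetOfOpensOver U q hq V ⟶ Z :=
  MorphismProperty.Over.homMk (V.ι ≫ l)
    ((Category.assoc _ _ _).trans ((congrArg (V.ι ≫ ·) hl).trans (Category.assoc _ _ _).symm))

/-- Its underlying morphism of schemes is `V ↪ Y → Z` (by `rfl`). [folklore] -/
@[simp] theorem proetOfOpensOverHom_left (U : X.ProEt) {Y : Scheme.{u}} (q : Y ⟶ U.left)
    (hq : WeaklyEtale q) (V : Y.Opens) (Z : X.ProEt) (l : Y ⟶ Z.left)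
    (hl : l ≫ Z.hom = q ≫ U.hom) : (proetOfOpensOverHom U q hq V Z l hl).left = V.ι ≫ l := rfl

/-- **A pro-étale covering sieve of a quasi-compact `U ∈ X_proét` contains finitely many morphisms
from affine objects which are jointly surjective.** Covers of `X_proét` are fpqc covers
(Bhatt–Scholze Def. 4.1.1: "any open affine in `Y` is mapped onto by an open affine in `⊔_i Y_i`";
Mathlib: `ProEt.topology` is generated by the comap of `proetalePrecoverage = qcPrecoverage ⊓
precoverage @WeaklyEtale`), so a covering sieve `R` of `U` contains a quasi-compact cover
`{Y_j → U}`; `U` being quasi-compact, finitely many affine opens `V_k` of the `Y_j` map onto `U`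
(Mathlib `QuasiCompactCover.exists_isAffineOpen_of_isCompact`), and each `V_k ↪ Y_j → U` is a
morphism of `X_proét` lying in `R`. [cite: BhattScholze2015, Def. 4.1.1] -/
theorem exists_finite_affine_of_mem_proEtTopology {U : X.ProEt} [CompactSpace U.left]
    {R : Sieve U} (hR : R ∈ Scheme.ProEt.topology X U) :
    ∃ (n : ℕ) (W : Fin n → X.ProEt) (g : ∀ k, W k ⟶ U), (∀ k, IsAffine (W k).left) ∧
      (∀ k, R (g k)) ∧ ∀ x : U.left, ∃ (k : Fin n) (y : (W k).left), (g k).left y = x := by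
  have h₁ := (MorphismProperty.coverPreserving_comap_forget (S := X) Scheme.proetalePrecoverage
    Scheme.proetalePrecoverage_le_precoverage_weaklyEtale).cover_preserve hR
  rw [GrothendieckTopology.mem_over_iff] at h₁
  obtain ⟨R₀, hR₀, hle⟩ :=
    (Precoverage.mem_toGrothendieck_iff_of_isStableUnderComposition).1 h₁
  obtain ⟨𝒰, rfl⟩ := Precoverage.mem_iff_exists_zeroHypercover.1 hR₀
  let 𝒰' : Scheme.Cover (Scheme.propQCPrecoverage @WeaklyEtale) U.left := 𝒰
  obtain ⟨n, f, V, hV, hcov⟩ := QuasiCompactCover.exists_isAffineOpen_of_isCompact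
    𝒰'.toPreZeroHypercover (U := ⊤) isCompact_univ
  choose Z g h hg hfac using fun k : Fin n =>
    (Sieve.overEquiv_iff _ _).1 (hle _ _ (Presieve.ofArrows.mk (f k)))
  have hq : ∀ k, WeaklyEtale (𝒰'.f (f k)) := fun k =>
    inferInstanceAs (WeaklyEtale (𝒰'.forgetQc.f (f k)))
  have hl : ∀ k, (h k).left ≫ (Z k).hom = 𝒰'.f (f k) ≫ U.hom := fun k => Over.w (h k)
  refine ⟨n, fun k => proetOfOpensOver U (𝒰'.f (f k)) (hq k) (V k),
    fun k => proetOfOpensOverHom U (𝒰'.f (f k)) (hq k) (V k) (Z k) (h k).left (hl k) ≫ g k,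
    fun k => hV k, fun k => R.downward_closed (hg k) _, fun x => ?_⟩
  have hx : x ∈ ⋃ k, 𝒰'.f (f k) '' (V k : Set (𝒰'.X (f k))) := by
    rw [hcov]
    trivial
  obtain ⟨k, v, hv, hvx⟩ : ∃ k v, v ∈ (V k : Set (𝒰'.X (f k))) ∧ 𝒰'.f (f k) v = x := by
    simpa only [Set.mem_iUnion, Set.mem_image] using hx
  refine ⟨k, ⟨v, hv⟩, ?_⟩
  have := congrArg (fun m => m.left v) (hfac k)
  simp only [Over.homMk_left] at this
  change ((V k).ι ≫ (h k).left ≫ (g k).left) ⟨v, hv⟩ = x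
  rw [Scheme.Hom.comp_apply, Scheme.Opens.ι_apply]
  exact this.symm.trans hvx

/-- **Under Lemma 4.2.4, a pro-étale covering sieve of a quasi-compact `U` contains finitely many
morphisms from pro-étale affines which are jointly surjective**: refine the finitely many affine
pieces of `exists_finite_affine_of_mem_proEtTopology` once more, using that each (quasi-compact)
affine piece is covered by morphisms factoring through pro-étale affines (cover density).
[cite: BhattScholze2015, Lemma 4.2.4] -/
theorem exists_finite_proetAffine_of_mem_proEtTopology
    [(proetAffineInclusion X).IsCoverDense (Scheme.ProEt.topology X)]
    {U : X.ProEt} [CompactSpace U.left] {R : Sieve U} (hR : R ∈ Scheme.ProEt.topology X U) :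
    ∃ (ι : Type) (_ : Finite ι) (W : ι → ProetAffine X) (g : ∀ i, (W i).obj ⟶ U),
      (∀ i, R (g i)) ∧ ∀ x : U.left, ∃ (i : ι) (y : (W i).obj.left), (g i).left y = x := by
  obtain ⟨n, W₀, g₀, hW₀, hg₀, hs₀⟩ := exists_finite_affine_of_mem_proEtTopology hR
  haveI : ∀ k, IsAffine (W₀ k).left := hW₀
  have hk : ∀ k, ∃ (m : ℕ) (W₁ : Fin m → X.ProEt) (g₁ : ∀ j, W₁ j ⟶ W₀ k),
      (∀ j, Sieve.coverByImage (proetAffineInclusion X) (W₀ k) (g₁ j)) ∧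
        ∀ x : (W₀ k).left, ∃ (j : Fin m) (y : (W₁ j).left), (g₁ j).left y = x := fun k => by
    obtain ⟨m, W₁, g₁, -, hg₁, hs₁⟩ := exists_finite_affine_of_mem_proEtTopology
      ((proetAffineInclusion X).is_cover_of_isCoverDense (Scheme.ProEt.topology X) (W₀ k))
    exact ⟨m, W₁, g₁, hg₁, hs₁⟩
  choose m W₁ g₁ hg₁ hs₁ using hk
  have str : ∀ k j, Presieve.CoverByImageStructure (proetAffineInclusion X) (g₁ k j) :=
    fun k j => (hg₁ k j).some
  refine ⟨Σ k : Fin n, Fin (m k), inferInstance, fun p => (str p.1 p.2).obj,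
    fun p => (str p.1 p.2).map ≫ g₀ p.1, fun p => R.downward_closed (hg₀ p.1) _, fun x => ?_⟩
  obtain ⟨k, y, rfl⟩ := hs₀ x
  obtain ⟨j, z, rfl⟩ := hs₁ k y
  refine ⟨⟨k, j⟩, (str k j).lift.left z, ?_⟩
  have hfac : (str k j).lift ≫ (str k j).map = g₁ k j := (str k j).fac
  exact congrArg (fun q : W₁ k j ⟶ W₀ k => (g₀ k).left (q.left z)) hfac

/-- Objects of `X_proét^aff` have affine underlying scheme. [cite: BhattScholze2015, Def. 4.2.1] -/
instance isAffine_proetAffine_obj_left (U : ProetAffine X) : IsAffine U.obj.left :=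
  U.property.elim fun 𝔭 => isAffine_left_of_presentation 𝔭

/-- **Under Lemma 4.2.4, a covering sieve of `U ∈ X_proét^aff` for the induced topology contains a
finite jointly surjective family of morphisms of `X_proét^aff`** (its push-forward is a pro-étale
covering sieve of the affine, hence quasi-compact, `U`; apply
`exists_finite_proetAffine_of_mem_proEtTopology` and pull the factorizations back to `X_proét^aff`).
This is the "covers defined to be fpqc covers" description of the site `X_proét^aff`
(Bhatt–Scholze Remark 4.2.5). [cite: BhattScholze2015, Remark 4.2.5 and Lemma 4.2.4] -/
theorem exists_finite_of_mem_proetAffineTopology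
    [(proetAffineInclusion X).IsCoverDense (Scheme.ProEt.topology X)]
    {U : ProetAffine X} {T : Sieve U} (hT : T ∈ proetAffineTopology X U) :
    ∃ (ι : Type) (_ : Finite ι) (V : ι → ProetAffine X) (t : ∀ i, V i ⟶ U),
      (∀ i, T (t i)) ∧ ∀ x : U.obj.left, ∃ (i : ι) (y : (V i).obj.left), (t i).hom.left y = x := by
  rw [Functor.mem_inducedTopology_iff_of_isCoverDense] at hT
  haveI : CompactSpace ((proetAffineInclusion X).obj U).left :=
    inferInstanceAs (CompactSpace U.obj.left)
  obtain ⟨ι, _, W, g, hg, hs⟩ := exists_finite_proetAffine_of_mem_proEtTopology hT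
  choose V' t h' ht hfac using hg
  refine ⟨ι, inferInstance, V', t, ht, fun x => ?_⟩
  obtain ⟨i, y, rfl⟩ := hs x
  refine ⟨i, (h' i).left y, ?_⟩
  exact (congrArg (fun q : (W i).obj ⟶ _ => q.left y) (hfac i)).symm

/-- **A finite jointly surjective family of morphisms of `X_proét` from affine objects to an affine
object generates a pro-étale covering sieve**: it is a quasi-compact cover (finitely many
quasi-compact morphisms, Mathlib `QuasiCompactCover.of_finite`) by weakly étale maps
(`weaklyEtale_left`), i.e. an fpqc cover in the sense of Def. 4.1.1. [cite: BhattScholze2015, Def. 4.1.1] -/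
theorem ofArrows_mem_proEtTopology {U : X.ProEt} [IsAffine U.left] {ι : Type} [Finite ι]
    (W : ι → X.ProEt) [∀ i, IsAffine (W i).left] (g : ∀ i, W i ⟶ U)
    (hs : ∀ x : U.left, ∃ (i : ι) (y : (W i).left), (g i).left y = x) :
    Sieve.ofArrows W g ∈ Scheme.ProEt.topology X U := by
  let 𝒱 : Scheme.Cover (Scheme.precoverage @WeaklyEtale) U.left :=
    Scheme.Cover.mkOfCovers ι (fun i => (W i).left) (fun i => (g i).left) hs
      (fun i => weaklyEtale_left (g i))
  haveI : Finite 𝒱.I₀ := ‹Finite ι›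
  haveI : ∀ i, QuasiCompact (𝒱.f i) := fun i => inferInstanceAs (QuasiCompact (g i).left)
  haveI : QuasiCompactCover 𝒱.toPreZeroHypercover := QuasiCompactCover.of_finite
  have hmem : Presieve.ofArrows W g ∈ Scheme.ProEt.precoverage X U := by
    rw [Scheme.ProEt.precoverage, Precoverage.mem_comap_iff, Presieve.map_ofArrows]
    exact (Scheme.Cover.ofQuasiCompactCover 𝒱).mem₀
  exact Precoverage.generate_mem_toGrothendieck hmem

/-- **Under Lemma 4.2.4, a sieve of `X_proét^aff` containing a finite jointly surjective family is a
covering sieve for the induced topology** (its push-forward contains the pro-étale covering sieve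
generated by the family, `ofArrows_mem_proEtTopology`). With
`exists_finite_of_mem_proetAffineTopology`: the covering sieves of `X_proét^aff` are exactly those
containing a finite jointly surjective family. [cite: BhattScholze2015, Remark 4.2.5 and Lemma 4.2.4] -/
theorem mem_proetAffineTopology_of_exists
    [(proetAffineInclusion X).IsCoverDense (Scheme.ProEt.topology X)]
    {U : ProetAffine X} {T : Sieve U} {ι : Type} [Finite ι] (V : ι → ProetAffine X)
    (t : ∀ i, V i ⟶ U) (ht : ∀ i, T (t i))
    (hs : ∀ x : U.obj.left, ∃ (i : ι) (y : (V i).obj.left), (t i).hom.left y = x) :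
    T ∈ proetAffineTopology X U := by
  rw [Functor.mem_inducedTopology_iff_of_isCoverDense]
  refine GrothendieckTopology.superset_covering _ ?_
    (ofArrows_mem_proEtTopology (fun i => (V i).obj) (fun i => (t i).hom) hs)
  refine (Sieve.generate_le_iff _ _).2 ?_
  rintro _ _ ⟨i⟩
  exact Sieve.image_mem_functorPushforward _ _ (ht i)

end Covers

end Literature.AlgebraicGeometry.Motives

end
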